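import Mathlib
import HarnessLib
import Summits.KontsevichZagierPeriods.Zeta5Search.BarnesKernelBounds

/-!
# ζ(5) search — the Barnes kernel of the very-well-poised series `F_m`: decay and absolute convergence (cell `pub-zeta5`, ct-1 g27)

HONEST FRAMING: systematic search; no irrationality claim unless kernel-certified.  Estimates for a special function (Stirling on
vertical lines); nothing here is an irrationality result, a worthiness exponent or a denominator statement; no named fact is
discharged; no definition is introduced.

First piece of brick B4 of `HOME/ct-1/g26/VWP-BLUEPRINT.md` (the Barnes-integral representation of Zudilin's very-well-poised series
`F_m(h₀;h₁,…,h_m)`, math/0206177 (1), at COMPLEX parameters; Nesterenko 2003, Lemma 3).  The Barnes integrand on `s = −s₁ + iy` is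

  `V(y) = (h₀ + 2s) · ∏_{j=0}^{m} Γ(h_j + s) · Γ(−s) / ∏_{j=1}^{m} Γ(1 + h₀ − h_j + s)`   (times the phase `e^{iεπs}`).

* `norm_prod_Gamma_shift_le`, `norm_prod_Gamma_shift_inv_le` — Finset-product versions of the shifted two-sided Stirling bounds of
  `BarnesKernelBounds`;
* `norm_vwpKernel_le` — `‖V(y)‖ ≤ C |y|^{E} e^{−π|y|}` for `|y| ≥ R`, with the raw exponent
  `E = 1 + Σ_{j≤m}(Re h_j − s₁ − ½) + (s₁ − ½) − Σ_{j<m}(Re(1+h₀−h_{j+1}) − s₁ − ½)`, and `exponent_eq`: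
  `E = 2 Σ_{j=1}^{m} Re h_j − (m−1) Re h₀ − m`;
* `continuous_vwpKernel` (no poles on the line), `integrable_of_tail` / `integrable_norm_mul_exp_pi_of_tail` (generic tail lemmas),
  `integrable_vwpKernel`, and **`integrable_norm_vwpKernel_mul_exp_pi`** — `y ↦ ‖V(y)‖e^{π|y|}` (the majorant with the phase
  `e^{±iπs}`) is integrable EXACTLY under Zudilin's (5): `2 Σ_{j=1}^m Re h_j < (m−1)(1 + Re h₀)`.

Theorems only; imports `Zeta5Search/BarnesKernelBounds`.
-/

noncomputable section

namespace Summit.KontsevichZagierPeriods.Zeta5Search.VWPBarnesKernel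

open MeasureTheory Set Filter
open scoped Real
open Summit.KontsevichZagierPeriods.Zeta5Search.BarnesKernelBounds
open Summit.KontsevichZagierPeriods.Zeta5Search.BarnesMellin (ne_neg_nat_of_re_pos integrable_of_norm_le_exp)

/-! ### 1. Finset-product Stirling bounds -/

/-- Product of shifted upper Stirling bounds: `∏_{j∈S} ‖Γ(c_j + s)‖ ≤ C |y|^{Σ_{j∈S}(Re c_j − t₀ − ½)} e^{−(π|y|/2)·#S}` far out. -/
theorem norm_prod_Gamma_shift_le (S : Finset ℕ) (c : ℕ → ℂ) (t₀ : ℝ) :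
    ∃ C : ℝ, 0 < C ∧ ∃ R : ℝ, 1 ≤ R ∧ ∀ y : ℝ, R ≤ |y| →
      ∏ j ∈ S, ‖Complex.Gamma (c j + (-(t₀ : ℂ) + (y : ℂ) * Complex.I))‖ ≤
        C * |y| ^ (∑ j ∈ S, ((c j).re - t₀ - 1 / 2)) * Real.exp (-(π * |y|) / 2 * (S.card : ℝ)) := by
  classical
  induction S using Finset.induction_on with
  | empty => exact ⟨1, one_pos, 1, le_rfl, fun y _ => by simp⟩
  | insert a S ha ih =>
    obtain ⟨C₁, hC₁, R₁, hR₁, h₁⟩ := ih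
    obtain ⟨C₂, hC₂, R₂, hR₂, h₂⟩ := norm_Gamma_shift_le (c a) t₀
    refine ⟨C₂ * C₁, mul_pos hC₂ hC₁, max R₁ R₂, le_max_of_le_left hR₁, fun y hy => ?_⟩
    have hy₁ : R₁ ≤ |y| := le_trans (le_max_left _ _) hy
    have hy₂ : R₂ ≤ |y| := le_trans (le_max_right _ _) hy
    have hy0 : 0 < |y| := by linarith
    rw [Finset.prod_insert ha, Finset.sum_insert ha, Finset.card_insert_of_notMem ha]
    push_cast
    calc ‖Complex.Gamma (c a + (-(t₀ : ℂ) + (y : ℂ) * Complex.I))‖ *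
          ∏ j ∈ S, ‖Complex.Gamma (c j + (-(t₀ : ℂ) + (y : ℂ) * Complex.I))‖
        ≤ (C₂ * |y| ^ ((c a).re - t₀ - 1 / 2) * Real.exp (-(π * |y|) / 2)) *
          (C₁ * |y| ^ (∑ j ∈ S, ((c j).re - t₀ - 1 / 2)) * Real.exp (-(π * |y|) / 2 * (S.card : ℝ))) :=
          mul_le_mul (h₂ y hy₂) (h₁ y hy₁) (Finset.prod_nonneg fun _ _ => norm_nonneg _) (by positivity)
      _ = C₂ * C₁ * |y| ^ ((c a).re - t₀ - 1 / 2 + ∑ j ∈ S, ((c j).re - t₀ - 1 / 2)) *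
          Real.exp (-(π * |y|) / 2 * ((S.card : ℝ) + 1)) := by
          rw [Real.rpow_add hy0, show -(π * |y|) / 2 * ((S.card : ℝ) + 1) = -(π * |y|) / 2 + -(π * |y|) / 2 * (S.card : ℝ) by ring,
            Real.exp_add]
          ring

/-- Product of shifted reciprocal lower Stirling bounds: `∏_{j∈S} ‖Γ(c_j + s)‖⁻¹ ≤ C |y|^{−Σ(Re c_j − t₀ − ½)} e^{(π|y|/2)·#S}`. -/
theorem norm_prod_Gamma_shift_inv_le (S : Finset ℕ) (c : ℕ → ℂ) (t₀ : ℝ) :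
    ∃ C : ℝ, 0 < C ∧ ∃ R : ℝ, 1 ≤ R ∧ ∀ y : ℝ, R ≤ |y| →
      ∏ j ∈ S, ‖Complex.Gamma (c j + (-(t₀ : ℂ) + (y : ℂ) * Complex.I))‖⁻¹ ≤
        C * |y| ^ (-∑ j ∈ S, ((c j).re - t₀ - 1 / 2)) * Real.exp (π * |y| / 2 * (S.card : ℝ)) := by
  classical
  induction S using Finset.induction_on with
  | empty => exact ⟨1, one_pos, 1, le_rfl, fun y _ => by simp⟩
  | insert a S ha ih =>
    obtain ⟨C₁, hC₁, R₁, hR₁, h₁⟩ := ih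
    obtain ⟨C₂, hC₂, R₂, hR₂, h₂⟩ := norm_Gamma_shift_inv_le (c a) t₀
    refine ⟨C₂ * C₁, mul_pos hC₂ hC₁, max R₁ R₂, le_max_of_le_left hR₁, fun y hy => ?_⟩
    have hy₁ : R₁ ≤ |y| := le_trans (le_max_left _ _) hy
    have hy₂ : R₂ ≤ |y| := le_trans (le_max_right _ _) hy
    have hy0 : 0 < |y| := by linarith
    rw [Finset.prod_insert ha, Finset.sum_insert ha, Finset.card_insert_of_notMem ha]
    push_cast
    calc ‖Complex.Gamma (c a + (-(t₀ : ℂ) + (y : ℂ) * Complex.I))‖⁻¹ *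
          ∏ j ∈ S, ‖Complex.Gamma (c j + (-(t₀ : ℂ) + (y : ℂ) * Complex.I))‖⁻¹
        ≤ (C₂ * |y| ^ (-((c a).re - t₀ - 1 / 2)) * Real.exp (π * |y| / 2)) *
          (C₁ * |y| ^ (-∑ j ∈ S, ((c j).re - t₀ - 1 / 2)) * Real.exp (π * |y| / 2 * (S.card : ℝ))) :=
          mul_le_mul (h₂ y hy₂) (h₁ y hy₁) (Finset.prod_nonneg fun _ _ => inv_nonneg.2 (norm_nonneg _)) (by positivity)
      _ = C₂ * C₁ * |y| ^ (-((c a).re - t₀ - 1 / 2 + ∑ j ∈ S, ((c j).re - t₀ - 1 / 2))) *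
          Real.exp (π * |y| / 2 * ((S.card : ℝ) + 1)) := by
          rw [neg_add, Real.rpow_add hy0, show π * |y| / 2 * ((S.card : ℝ) + 1) = π * |y| / 2 + π * |y| / 2 * (S.card : ℝ) by ring,
            Real.exp_add]
          ring

/-! ### 2. The kernel of `F_m` -/

/-- The linear factor: `‖h₀ + 2s‖ ≤ (‖h₀‖ + 2t₀ + 2)|y|` for `|y| ≥ 1` (`t₀ ≥ 0`). -/
theorem norm_linear_le (h₀ : ℂ) {t₀ : ℝ} (ht₀ : 0 ≤ t₀) {y : ℝ} (hy : 1 ≤ |y|) :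
    ‖h₀ + 2 * (-(t₀ : ℂ) + (y : ℂ) * Complex.I)‖ ≤ (‖h₀‖ + 2 * t₀ + 2) * |y| ^ (1 : ℝ) := by
  rw [Real.rpow_one]
  calc ‖h₀ + 2 * (-(t₀ : ℂ) + (y : ℂ) * Complex.I)‖ ≤ ‖h₀‖ + ‖2 * (-(t₀ : ℂ) + (y : ℂ) * Complex.I)‖ := norm_add_le _ _
    _ ≤ ‖h₀‖ + 2 * (t₀ + |y|) := by
        rw [norm_mul, Complex.norm_two]
        have : ‖(-(t₀ : ℂ) + (y : ℂ) * Complex.I)‖ ≤ t₀ + |y| :=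
          calc ‖(-(t₀ : ℂ) + (y : ℂ) * Complex.I)‖ ≤ ‖-(t₀ : ℂ)‖ + ‖(y : ℂ) * Complex.I‖ := norm_add_le _ _
            _ = t₀ + |y| := by
                rw [norm_neg, Complex.norm_real, norm_mul, Complex.norm_I, mul_one, Complex.norm_real,
                  Real.norm_eq_abs, Real.norm_eq_abs, abs_of_nonneg ht₀]
        linarith
    _ ≤ (‖h₀‖ + 2 * t₀ + 2) * |y| := by nlinarith [norm_nonneg h₀]

/-- **Decay of the `F_m` Barnes kernel** on `s = −s₁ + iy`: with the raw exponent
`E = 1 + Σ_{j≤m}(Re h_j − s₁ − ½) + (s₁ − ½) − Σ_{j<m}(Re(1+h₀−h_{j+1}) − s₁ − ½)` there are `C > 0`, `R ≥ 1` with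
`‖(h₀+2s)∏_{j≤m}Γ(h_j+s)Γ(−s)/∏_{j<m}Γ(1+h₀−h_{j+1}+s)‖ ≤ C|y|^{E}e^{−π|y|}` for `|y| ≥ R` (`s₁ ≥ 0`; no other hypothesis). -/
theorem norm_vwpKernel_le (m : ℕ) (h : ℕ → ℂ) {s₁ : ℝ} (hs₁ : 0 ≤ s₁) :
    ∃ C : ℝ, 0 < C ∧ ∃ R : ℝ, 1 ≤ R ∧ ∀ y : ℝ, R ≤ |y| →
      ‖(h 0 + 2 * (-(s₁ : ℂ) + (y : ℂ) * Complex.I)) *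
            (∏ j ∈ Finset.range (m + 1), Complex.Gamma (h j + (-(s₁ : ℂ) + (y : ℂ) * Complex.I))) *
            Complex.Gamma (-(-(s₁ : ℂ) + (y : ℂ) * Complex.I)) /
          ∏ j ∈ Finset.range m, Complex.Gamma (1 + h 0 - h (j + 1) + (-(s₁ : ℂ) + (y : ℂ) * Complex.I))‖ ≤
        C * |y| ^ (1 + (∑ j ∈ Finset.range (m + 1), ((h j).re - s₁ - 1 / 2)) + (s₁ - 1 / 2) +
            -(∑ j ∈ Finset.range m, ((1 + h 0 - h (j + 1)).re - s₁ - 1 / 2))) * Real.exp (-(π * |y|)) := by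
  obtain ⟨C₁, hC₁, R₁, hR₁, h₁⟩ := norm_prod_Gamma_shift_le (Finset.range (m + 1)) h s₁
  obtain ⟨C₃, hC₃, h₃⟩ := norm_Gamma_neg_line_le s₁
  obtain ⟨C₄, hC₄, R₄, hR₄, h₄⟩ := norm_prod_Gamma_shift_inv_le (Finset.range m) (fun j => 1 + h 0 - h (j + 1)) s₁
  refine ⟨(‖h 0‖ + 2 * s₁ + 2) * C₁ * C₃ * C₄, by positivity, max R₁ R₄, le_max_of_le_left hR₁, fun y hy => ?_⟩
  have hy₁ : R₁ ≤ |y| := le_trans (le_max_left _ _) hy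
  have hy₄ : R₄ ≤ |y| := le_trans (le_max_right _ _) hy
  have hy1 : 1 ≤ |y| := le_trans hR₁ hy₁
  have hy0 : 0 < |y| := by linarith
  have g0 := norm_linear_le (h 0) hs₁ hy1
  have g1 := h₁ y hy₁
  have g3 := h₃ y hy1
  have g4 := h₄ y hy₄
  rw [Finset.card_range] at g1 g4
  rw [norm_div, norm_mul, norm_mul, norm_prod, norm_prod, div_eq_mul_inv, ← Finset.prod_inv_distrib]
  set E₁ : ℝ := ∑ j ∈ Finset.range (m + 1), ((h j).re - s₁ - 1 / 2) with hE₁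
  set E₄ : ℝ := ∑ j ∈ Finset.range m, ((1 + h 0 - h (j + 1)).re - s₁ - 1 / 2) with hE₄
  have hP : |y| ^ (1 : ℝ) * |y| ^ E₁ * |y| ^ (s₁ - 1 / 2) * |y| ^ (-E₄) = |y| ^ (1 + E₁ + (s₁ - 1 / 2) + -E₄) := by
    rw [← Real.rpow_add hy0, ← Real.rpow_add hy0, ← Real.rpow_add hy0]
  have hX : Real.exp (-(π * |y|) / 2 * ((m + 1 : ℕ) : ℝ)) * Real.exp (-(π * |y|) / 2) * Real.exp (π * |y| / 2 * (m : ℝ)) =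
      Real.exp (-(π * |y|)) := by
    rw [← Real.exp_add, ← Real.exp_add]; push_cast; congr 1; ring
  calc ‖h 0 + 2 * (-(s₁ : ℂ) + (y : ℂ) * Complex.I)‖ *
          (∏ j ∈ Finset.range (m + 1), ‖Complex.Gamma (h j + (-(s₁ : ℂ) + (y : ℂ) * Complex.I))‖) *
          ‖Complex.Gamma (-(-(s₁ : ℂ) + (y : ℂ) * Complex.I))‖ *
          ∏ j ∈ Finset.range m, ‖Complex.Gamma (1 + h 0 - h (j + 1) + (-(s₁ : ℂ) + (y : ℂ) * Complex.I))‖⁻¹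
      ≤ ((‖h 0‖ + 2 * s₁ + 2) * |y| ^ (1 : ℝ)) * (C₁ * |y| ^ E₁ * Real.exp (-(π * |y|) / 2 * ((m + 1 : ℕ) : ℝ))) *
          (C₃ * |y| ^ (s₁ - 1 / 2) * Real.exp (-(π * |y|) / 2)) * (C₄ * |y| ^ (-E₄) * Real.exp (π * |y| / 2 * (m : ℝ))) :=
        mul_le_mul (mul_le_mul (mul_le_mul g0 g1 (Finset.prod_nonneg fun _ _ => norm_nonneg _) (by positivity)) g3
          (norm_nonneg _) (by positivity)) g4 (Finset.prod_nonneg fun _ _ => inv_nonneg.2 (norm_nonneg _)) (by positivity)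
    _ = (‖h 0‖ + 2 * s₁ + 2) * C₁ * C₃ * C₄ * (|y| ^ (1 : ℝ) * |y| ^ E₁ * |y| ^ (s₁ - 1 / 2) * |y| ^ (-E₄)) *
          (Real.exp (-(π * |y|) / 2 * ((m + 1 : ℕ) : ℝ)) * Real.exp (-(π * |y|) / 2) * Real.exp (π * |y| / 2 * (m : ℝ))) := by
        ring
    _ = _ := by rw [hP, hX]

/-- **The exponent in Zudilin's form**: `E = 2 Σ_{j=1}^{m} Re h_j − (m−1) Re h₀ − m`, so `E < −1` is exactly the printed (5)
`(m−1)(1 + Re h₀) > 2 Σ_{j=1}^{m} Re h_j`. -/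
theorem exponent_eq (m : ℕ) (h : ℕ → ℂ) (s₁ : ℝ) :
    1 + (∑ j ∈ Finset.range (m + 1), ((h j).re - s₁ - 1 / 2)) + (s₁ - 1 / 2) +
        -(∑ j ∈ Finset.range m, ((1 + h 0 - h (j + 1)).re - s₁ - 1 / 2)) =
      2 * (∑ j ∈ Finset.range m, (h (j + 1)).re) - ((m : ℝ) - 1) * (h 0).re - m := by
  rw [Finset.sum_range_succ']
  simp only [Finset.sum_sub_distrib, Finset.sum_const, Finset.card_range, nsmul_eq_mul, Complex.add_re, Complex.sub_re,
    Complex.one_re]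
  ring

/-- **Continuity of the kernel** on the line when it meets no pole: `0 < s₁ < Re h_j` (`j ≤ m`) and `s₁ < Re(1 + h₀ − h_{j+1})`
(`j < m`). -/
theorem continuous_vwpKernel (m : ℕ) (h : ℕ → ℂ) {s₁ : ℝ} (hs₁ : 0 < s₁) (hnum : ∀ j, j ≤ m → s₁ < (h j).re)
    (hden : ∀ j, j < m → s₁ < (1 + h 0 - h (j + 1)).re) :
    Continuous fun y : ℝ =>
      (h 0 + 2 * (-(s₁ : ℂ) + (y : ℂ) * Complex.I)) *
            (∏ j ∈ Finset.range (m + 1), Complex.Gamma (h j + (-(s₁ : ℂ) + (y : ℂ) * Complex.I))) *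
            Complex.Gamma (-(-(s₁ : ℂ) + (y : ℂ) * Complex.I)) /
          ∏ j ∈ Finset.range m, Complex.Gamma (1 + h 0 - h (j + 1) + (-(s₁ : ℂ) + (y : ℂ) * Complex.I)) := by
  have hΓ : ∀ (f : ℝ → ℂ), Continuous f → (∀ y, 0 < (f y).re) → Continuous fun y => Complex.Gamma (f y) := by
    intro f hf hpos
    refine continuous_iff_continuousAt.mpr fun y => (Complex.continuousAt_Gamma _ ?_).comp hf.continuousAt
    exact ne_neg_nat_of_re_pos (hpos y)
  refine Continuous.div ((Continuous.mul (by fun_prop) (continuous_finsetProd _ fun j hj => ?_)).mul ?_)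
    (continuous_finsetProd _ fun j hj => ?_) fun y => ?_
  · exact hΓ _ (by fun_prop) fun y => by have := hnum j (by simpa [Nat.lt_succ_iff] using hj); simp; linarith
  · exact hΓ _ (by fun_prop) fun y => by simp [hs₁]
  · exact hΓ _ (by fun_prop) fun y => by have := hden j (by simpa using hj); simp at this ⊢; linarith
  · exact Finset.prod_ne_zero_iff.2 fun j hj => Complex.Gamma_ne_zero_of_re_pos (by
      have := hden j (by simpa using hj); simp at this ⊢; linarith)

/-! ### 3. From tail bounds to integrability (generic) -/

/-- A continuous `g : ℝ → ℂ` with `‖g(y)‖ ≤ C|y|^{E}e^{−π|y|}` far out is integrable. -/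
theorem integrable_of_tail {g : ℝ → ℂ} (hg : Continuous g) {C E R : ℝ} (hR : 1 ≤ R)
    (hb : ∀ y : ℝ, R ≤ |y| → ‖g y‖ ≤ C * |y| ^ E * Real.exp (-(π * |y|))) : Integrable g := by
  set p : ℝ := max E 0 with hp
  obtain ⟨T₀, hT₀⟩ := Literature.Analysis.Complex.exists_rpow_mul_exp_neg_le (K := 1) zero_le_one (le_max_right E 0 : 0 ≤ p)
    (by linarith [Real.pi_gt_three] : (0 : ℝ) < π - 1) (ε := (|C| + 1)⁻¹) (by positivity)
  refine integrable_of_norm_le_exp hg one_pos (C := 1) (R := max R T₀) fun y hy => ?_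
  have hyR : R ≤ |y| := le_trans (le_max_left _ _) hy
  have hyT : T₀ ≤ |y| := le_trans (le_max_right _ _) hy
  have hy1 : 1 ≤ |y| := le_trans hR hyR
  have hq : |y| ^ E ≤ (1 + |y|) ^ p := BarnesMellinCpow.rpow_le_add_rpow_max hy1 zero_le_one
  have hexp : Real.exp (-(π * |y|)) = Real.exp (-((π - 1) * |y|)) * Real.exp (-1 * |y|) := by
    rw [← Real.exp_add]; ring_nf
  calc ‖g y‖ ≤ C * |y| ^ E * Real.exp (-(π * |y|)) := hb y hyR
    _ ≤ |C| * |y| ^ E * Real.exp (-(π * |y|)) := by gcongr; exact le_abs_self C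
    _ ≤ (|C| + 1) * (1 + |y|) ^ p * Real.exp (-(π * |y|)) := by gcongr; linarith
    _ = (|C| + 1) * ((1 + |y|) ^ p * Real.exp (-((π - 1) * |y|))) * Real.exp (-1 * |y|) := by rw [hexp]; ring
    _ ≤ (|C| + 1) * (|C| + 1)⁻¹ * Real.exp (-1 * |y|) := by gcongr; exact hT₀ y hyT
    _ = 1 * Real.exp (-1 * |y|) := by rw [mul_inv_cancel₀ (by positivity)]

/-- A continuous `g : ℝ → ℂ` with `‖g(y)‖ ≤ C|y|^{E}e^{−π|y|}` far out and `E < −1`: `y ↦ ‖g(y)‖e^{π|y|}` is integrable. -/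
theorem integrable_norm_mul_exp_pi_of_tail {g : ℝ → ℂ} (hg : Continuous g) {C E R : ℝ} (hR : 1 ≤ R) (hE : E < -1)
    (hb : ∀ y : ℝ, R ≤ |y| → ‖g y‖ ≤ C * |y| ^ E * Real.exp (-(π * |y|))) :
    Integrable fun y : ℝ => ‖g y‖ * Real.exp (π * |y|) := by
  have hcont : Continuous fun y : ℝ => ‖g y‖ * Real.exp (π * |y|) := hg.norm.mul (by fun_prop)
  obtain ⟨M, hM⟩ := (isCompact_Icc : IsCompact (Icc (-R) R)).exists_bound_of_continuousOn hcont.continuousOn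
  have hM0 : 0 ≤ M := le_trans (norm_nonneg _) (hM 0 (by constructor <;> linarith))
  set C' : ℝ := |C| * (2 : ℝ) ^ (-E) + M * (1 + R) ^ (-E) with hC'
  have hmaj : Integrable fun y : ℝ => C' * (1 + ‖y‖) ^ (-(-E)) :=
    (integrable_one_add_norm (E := ℝ) (μ := volume) (by simp; linarith)).const_mul C'
  refine hmaj.mono' hcont.aestronglyMeasurable (Eventually.of_forall fun y => ?_)
  rw [Real.norm_eq_abs, abs_of_nonneg (by positivity), neg_neg, Real.norm_eq_abs]
  have h1y : 0 < 1 + |y| := by positivity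
  by_cases hy : R ≤ |y|
  · have hy1 : 1 ≤ |y| := le_trans hR hy
    have hy0 : 0 < |y| := by linarith
    have hpow : |y| ^ E ≤ (2 : ℝ) ^ (-E) * (1 + |y|) ^ E := by
      have h2 : 1 + |y| ≤ 2 * |y| := by linarith
      have := Real.rpow_le_rpow_of_nonpos h1y h2 (by linarith : E ≤ 0)
      rw [Real.mul_rpow (by norm_num) (abs_nonneg y)] at this
      have h2q : (0 : ℝ) < 2 ^ E := Real.rpow_pos_of_pos (by norm_num) E
      rw [Real.rpow_neg (by norm_num : (0 : ℝ) ≤ 2)]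
      calc |y| ^ E = (2 ^ E)⁻¹ * (2 ^ E * |y| ^ E) := by field_simp
        _ ≤ (2 ^ E)⁻¹ * (1 + |y|) ^ E := mul_le_mul_of_nonneg_left this (by positivity)
    calc ‖g y‖ * Real.exp (π * |y|) ≤ (C * |y| ^ E * Real.exp (-(π * |y|))) * Real.exp (π * |y|) :=
          mul_le_mul_of_nonneg_right (hb y hy) (Real.exp_pos _).le
      _ = C * |y| ^ E := by
          rw [mul_assoc, ← Real.exp_add, show -(π * |y|) + π * |y| = 0 by ring, Real.exp_zero, mul_one]
      _ ≤ |C| * |y| ^ E := by gcongr; exact le_abs_self C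
      _ ≤ |C| * ((2 : ℝ) ^ (-E) * (1 + |y|) ^ E) := mul_le_mul_of_nonneg_left hpow (abs_nonneg C)
      _ ≤ C' * (1 + |y|) ^ E := by
          rw [hC', add_mul, ← mul_assoc]
          have : 0 ≤ M * (1 + R) ^ (-E) * (1 + |y|) ^ E := by positivity
          linarith
  · rw [not_le] at hy
    have hyI : y ∈ Icc (-R) R := by constructor <;> linarith [neg_abs_le y, le_abs_self y]
    have hMy := hM y hyI
    rw [Real.norm_eq_abs, abs_of_nonneg (by positivity)] at hMy
    have hpow : (1 + R) ^ E ≤ (1 + |y|) ^ E := Real.rpow_le_rpow_of_nonpos h1y (by linarith) (by linarith)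
    have hR0 : 0 < 1 + R := by linarith
    calc ‖g y‖ * Real.exp (π * |y|) ≤ M := hMy
      _ = M * (1 + R) ^ (-E) * (1 + R) ^ E := by
          rw [mul_assoc, Real.rpow_neg hR0.le, inv_mul_cancel₀ (Real.rpow_pos_of_pos hR0 E).ne', mul_one]
      _ ≤ M * (1 + R) ^ (-E) * (1 + |y|) ^ E := mul_le_mul_of_nonneg_left hpow (by positivity)
      _ ≤ C' * (1 + |y|) ^ E := by
          rw [hC', add_mul]
          have : 0 ≤ |C| * (2 : ℝ) ^ (-E) * (1 + |y|) ^ E := by positivity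
          linarith

/-! ### 4. Absolute convergence of the Barnes integral of `F_m` -/

/-- The kernel of `F_m` is integrable on the pole-free line `Re s = −s₁` (decay `e^{−π|y|}`; no condition on the parameters beyond
`0 < s₁ < Re h_j`, `s₁ < Re(1+h₀−h_{j+1})`). -/
theorem integrable_vwpKernel (m : ℕ) (h : ℕ → ℂ) {s₁ : ℝ} (hs₁ : 0 < s₁) (hnum : ∀ j, j ≤ m → s₁ < (h j).re)
    (hden : ∀ j, j < m → s₁ < (1 + h 0 - h (j + 1)).re) :
    Integrable fun y : ℝ =>
      (h 0 + 2 * (-(s₁ : ℂ) + (y : ℂ) * Complex.I)) *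
            (∏ j ∈ Finset.range (m + 1), Complex.Gamma (h j + (-(s₁ : ℂ) + (y : ℂ) * Complex.I))) *
            Complex.Gamma (-(-(s₁ : ℂ) + (y : ℂ) * Complex.I)) /
          ∏ j ∈ Finset.range m, Complex.Gamma (1 + h 0 - h (j + 1) + (-(s₁ : ℂ) + (y : ℂ) * Complex.I)) := by
  obtain ⟨C, -, R, hR, hb⟩ := norm_vwpKernel_le m h hs₁.le
  exact integrable_of_tail (continuous_vwpKernel m h hs₁ hnum hden) hR hb

/-- **Absolute convergence WITH the phase `e^{±iπs}`, exactly under Zudilin's (5)** [math/0206177, (5) and Remark; Nesterenko 2003,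
Lemma 3]: if moreover `2 Σ_{j=1}^{m} Re h_j < (m−1)(1 + Re h₀)`, then `y ↦ ‖V(y)‖e^{π|y|}` is integrable on `ℝ`. -/
theorem integrable_norm_vwpKernel_mul_exp_pi (m : ℕ) (h : ℕ → ℂ) {s₁ : ℝ} (hs₁ : 0 < s₁) (hnum : ∀ j, j ≤ m → s₁ < (h j).re)
    (hden : ∀ j, j < m → s₁ < (1 + h 0 - h (j + 1)).re)
    (h5 : 2 * (∑ j ∈ Finset.range m, (h (j + 1)).re) < ((m : ℝ) - 1) * (1 + (h 0).re)) :
    Integrable fun y : ℝ =>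
      ‖(h 0 + 2 * (-(s₁ : ℂ) + (y : ℂ) * Complex.I)) *
            (∏ j ∈ Finset.range (m + 1), Complex.Gamma (h j + (-(s₁ : ℂ) + (y : ℂ) * Complex.I))) *
            Complex.Gamma (-(-(s₁ : ℂ) + (y : ℂ) * Complex.I)) /
          ∏ j ∈ Finset.range m, Complex.Gamma (1 + h 0 - h (j + 1) + (-(s₁ : ℂ) + (y : ℂ) * Complex.I))‖ *
        Real.exp (π * |y|) := by
  obtain ⟨C, -, R, hR, hb⟩ := norm_vwpKernel_le m h hs₁.le
  rw [exponent_eq] at hb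
  exact integrable_norm_mul_exp_pi_of_tail (continuous_vwpKernel m h hs₁ hnum hden) hR (by linarith) hb

end Summit.KontsevichZagierPeriods.Zeta5Search.VWPBarnesKernel

end
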